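import Summits.RiemannHypothesis.RiemannHypothesis.Theses.WeilGroundState
import Summits.RiemannHypothesis.RiemannHypothesis.Theorems.WeilGroundStateGroundStateMellinRealZeros
import Literature.NumberTheory.LFunctions.WeilGroundState
import Literature.NumberTheory.LFunctions.WeilWindowSimpleEven
import Literature.NumberTheory.LFunctions.RiemannXiProofs
import Literature.Analysis.Complex.Hurwitz
import HarnessLib

/-!
# `WeilGroundState.GroundStatesConvergeToXi` — the parity/simplicity crux is needed only
FREQUENTLY along the witness windows
(crux item stmt-RiemannHypothesis-1527, route route-RiemannHypothesis-WeilGroundState; line `Sketch`,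
lead c3; `--supports`: sharpening of the route's assembly for the planner)

The route's deciding theorem `closes` uses `GroundStateSimpleEven` (crux #2, ∀ windows `a > 0`)
only at the witness windows `a_k` of `GroundStatesConvergeToXi` (crux #3).  Since Hurwitz's
theorem in the tree (`Complex.hurwitz_eqOn_zero_or_forall_ne_zero`) needs zero-freeness only
FREQUENTLY along the sequence, the window-`a` clause of crux #2 (`WeilWindowSimpleEven a`, the
hypothesis of Connes–van Suijlekom Thm 6.1, PROVED in the tree to put the zeros of `û` on the line)
is needed only for INFINITELY MANY witness windows:

* `riemannHypothesis_of_cruxWitness_frequently_windowSimpleEven` — a witness `(a_k, u_k, c_k)` of the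
  crux with `WeilWindowSimpleEven (a_k)` for infinitely many `k` proves RH;
* `eventually_not_windowSimpleEven_of_not_riemannHypothesis` — under `¬RH`, along every crux
  witness the bottom of the truncated Weil form is NOT simple-isolated-even at all but finitely
  many witness windows.
RH-free; no new definitions.
-/

noncomputable section

set_option linter.dupNamespace false

open scoped Topology Real ComplexConjugate
open Filter Set MeasureTheory Complex

namespace Summit.RiemannHypothesis.RiemannHypothesis.Theorems.GroundStatesConvergeToXi

open Literature.NumberTheory.LFunctions

/-- **Crux witness + parity/simplicity at infinitely many witness windows ⇒ RH.**  Let `u_k` be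
ground states at windows `a_k` and `c_k` scalars with `c_k · weilMellin u_k → ξ` locally uniformly
on the open strip, and suppose `WeilWindowSimpleEven (a_k)` (the bottom at `a_k` is simple,
isolated and even, variationally) for infinitely many `k`.  Then RH: at those `k`, C–vS
(`groundStateMellinRealZeros_proof`) puts all zeros of `weilMellin u_k` on `Re s = 1/2`, so
`c_k û_k` is zero-free on `U = {1/2 < Re s < 1}` frequently; Hurwitz gives `ξ ≡ 0` on `U`
(impossible) or `ξ` zero-free on `U`, and the functional equation finishes.  (`a_k → ∞` is not
needed; `c_k ≠ 0` only eventually.) [folklore] -/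
theorem riemannHypothesis_of_cruxWitness_frequently_windowSimpleEven
    {a : ℕ → ℝ} {u : ℕ → ℝ → ℂ} {c : ℕ → ℂ}
    (hu : ∀ k, IsWeilGroundState (a k) (u k)) (hc : ∀ᶠ k in atTop, c k ≠ 0)
    (hlim : TendstoLocallyUniformlyOn (fun k s => c k * weilMellin (u k) s) riemannXi atTop
      {s : ℂ | 0 < s.re ∧ s.re < 1})
    (hW : ∃ᶠ k in atTop, WeilWindowSimpleEven (a k)) : RiemannHypothesis := by
  classical
  -- at the good windows all zeros of `c_k û_k` lie on the critical line
  have hF : ∀ k, WeilWindowSimpleEven (a k) →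
      ∀ s, c k * weilMellin (u k) s = 0 → c k = 0 ∨ s.re = 1 / 2 := by
    intro k hk s hs
    rcases mul_eq_zero.1 hs with h | h
    · exact Or.inl h
    · obtain ⟨hu2, g, hg, hQ, hL2⟩ := hu k
      exact Or.inr ((groundStateMellinRealZeros_proof (a k) (hu k).pos hk (u k) hu2
        ⟨g, hg, hQ, hL2⟩).2 s h)
  set U : Set ℂ := {s : ℂ | 1 / 2 < s.re ∧ s.re < 1} with hUdef
  have hUo : IsOpen U :=
    (isOpen_lt continuous_const Complex.continuous_re).inter
      (isOpen_lt Complex.continuous_re continuous_const)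
  have hUc : Convex ℝ U := (convex_halfSpace_re_gt (1 / 2)).inter (convex_halfSpace_re_lt 1)
  have hlimU : TendstoLocallyUniformlyOn (fun k s => c k * weilMellin (u k) s) riemannXi atTop U :=
    hlim.mono fun s hs => ⟨by linarith [hs.1], hs.2⟩
  have hFd : ∀ᶠ k in atTop, DifferentiableOn ℂ (fun s => c k * weilMellin (u k) s) U :=
    Eventually.of_forall fun k =>
      ((differentiable_const (c k)).mul (hu k).differentiable_weilMellin).differentiableOn
  have hFne : ∃ᶠ k in atTop, ∀ z ∈ U, c k * weilMellin (u k) z ≠ 0 :=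
    (hW.and_eventually hc).mono fun k hk z hz hz0 => by
      rcases hF k hk.1 z hz0 with h | h
      · exact hk.2 h
      · linarith [hz.1]
  rcases Complex.hurwitz_eqOn_zero_or_forall_ne_zero hUo hUc.isPreconnected hFd hlimU hFne with
    hzero | hne
  · -- `ξ ≡ 0` on `U` is impossible
    exfalso
    have han : AnalyticOnNhd ℂ riemannXi Set.univ :=
      differentiable_riemannXi.differentiableOn.analyticOnNhd isOpen_univ
    have hz₀ : ((3 : ℂ) / 4) ∈ U := by
      refine ⟨?_, ?_⟩ <;> norm_num
    have hev : riemannXi =ᶠ[nhds ((3 : ℂ) / 4)] 0 :=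
      Filter.eventuallyEq_of_mem (hUo.mem_nhds hz₀) hzero
    have hall := han.eqOn_zero_of_preconnected_of_eventuallyEq_zero isPreconnected_univ
      (Set.mem_univ _) hev
    have h0 := hall (Set.mem_univ (0 : ℂ))
    rw [riemannXi_zero] at h0
    norm_num at h0
  · -- `ξ` is zero-free on `U`, hence (functional equation) on the whole open strip off the line
    intro s hzeta htriv hone
    have hxi := riemannXi_eq_zero_of_nontrivial hzeta htriv hone
    obtain ⟨-, h0, h1⟩ := (riemannXi_eq_zero_iff_holds s).1 hxi
    by_contra hne'
    rcases lt_or_gt_of_ne hne' with hlt | hgt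
    · refine hne (1 - s) ⟨?_, ?_⟩ ((riemannXi_one_sub s).trans hxi)
      · simp only [Complex.sub_re, Complex.one_re]; linarith
      · simp only [Complex.sub_re, Complex.one_re]; linarith
    · exact hne s ⟨hgt, h1⟩ hxi

/-- **The crux with parity/simplicity at infinitely many witness windows implies RH** (verbatim
clauses of `GroundStatesConvergeToXi` plus `∃ᶠ k, WeilWindowSimpleEven (a k)`; compare the
route's assembly, which assumes `GroundStateSimpleEven` at EVERY window). [folklore] -/
theorem riemannHypothesis_of_groundStatesConvergeToXi_frequently_windowSimpleEven
    (h : ∃ a : ℕ → ℝ, ∃ u : ℕ → ℝ → ℂ, ∃ c : ℕ → ℂ, Tendsto a atTop atTop ∧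
      (∀ k, 0 < a k ∧ c k ≠ 0 ∧ MemLp (u k) 2 ∧ ∃ g : ℕ → ℝ → ℂ,
        (∀ n, IsWeilTest (g n) ∧ tsupport (g n) ⊆ Icc (-(a k)) (a k) ∧ ∫ t, ‖g n t‖ ^ 2 = (1 : ℝ)) ∧
        Tendsto (fun n => (weilQuadratic (g n)).re) atTop (𝓝 (weilGroundEnergy (a k))) ∧
        Tendsto (fun n => ∫ t, ‖g n t - u k t‖ ^ 2) atTop (𝓝 0)) ∧
      TendstoLocallyUniformlyOn (fun k s => c k * weilMellin (u k) s) riemannXi atTop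
        {s : ℂ | 0 < s.re ∧ s.re < 1} ∧
      ∃ᶠ k in atTop, WeilWindowSimpleEven (a k)) :
    RiemannHypothesis := by
  obtain ⟨a, u, c, -, hk, hlim, hW⟩ := h
  exact riemannHypothesis_of_cruxWitness_frequently_windowSimpleEven
    (fun k => ⟨(hk k).2.2.1, (hk k).2.2.2⟩) (Eventually.of_forall fun k => (hk k).2.1) hlim hW

/-- **Under `¬RH`, a crux witness lives at windows WITHOUT a simple-isolated-even bottom, for all
but finitely many of its windows.** [folklore] -/
theorem eventually_not_windowSimpleEven_of_not_riemannHypothesis (hRH : ¬ RiemannHypothesis)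
    {a : ℕ → ℝ} {u : ℕ → ℝ → ℂ} {c : ℕ → ℂ}
    (hu : ∀ k, IsWeilGroundState (a k) (u k)) (hc : ∀ᶠ k in atTop, c k ≠ 0)
    (hlim : TendstoLocallyUniformlyOn (fun k s => c k * weilMellin (u k) s) riemannXi atTop
      {s : ℂ | 0 < s.re ∧ s.re < 1}) :
    ∀ᶠ k in atTop, ¬ WeilWindowSimpleEven (a k) := by
  by_contra h
  rw [not_eventually] at h
  exact hRH (riemannHypothesis_of_cruxWitness_frequently_windowSimpleEven hu hc hlim
    (h.mono fun k hk => not_not.1 hk))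

end Summit.RiemannHypothesis.RiemannHypothesis.Theorems.GroundStatesConvergeToXi

end
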